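import Literature.AlgebraicGeometry.Hu2025.Proofs.S03Pluecker.GammaQuadCell
import Literature.AlgebraicGeometry.Hu2025.Proofs.S03Pluecker.Prop36
import HarnessLib

/-!
# Hu 2025 — the THIN SCHUBERT CELL of the complete quadrilateral is integral, part 2: the localised Γ-scheme ring embeds
# into the parametrisation domain (joint J1 / GAP-LEDGER-HU row HU-R01 — kernel support, OURS)

**HONEST FRAMING (D-0012/D-0089).** [Hu2025] is an unrefereed preprint under adjudication; nothing of it is asserted. OURS objects only:
`Rq = k[x_u]_{u ∈ 𝕀_{3,9} ∖ m} ⧸ ((𝓕_m) + (x̄_u : u ∈ Γ))` (the typed Γ-scheme ring of the complete quadrilateral, rows 101/109),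
`hq =` the product of the chart coordinates `x̄_u`, `u ∉ Γ`, `Rh = Rq[1/hq]` (the coordinate ring of the open matroid cell inside `Z_Γ`).
MAIN: `isDomain_awayGammaChart_quad` — `Rh` is a DOMAIN (`k` a field of characteristic `0`), by an explicit ring map `Φ̄ : Rh → S`
into the parametrisation domain of part 1 with a retraction `Ψ ∘ Φ̄ = id`. AI proof is weaker than expert review.
-/

noncomputable section

namespace Literature.AlgebraicGeometry.Hu2025.Statements.S03Pluecker

open MvPolynomial Matrix

namespace QuadCell

variable (k : Type) [Field k]

/-! ## The rings `Rq`, `Rh` -/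

/-- **`Rq`** — the typed Γ-scheme ring of the complete quadrilateral on the chart (`n = 9`). OURS abbreviation.
[cite: Hu2025, Def. 7.1 (Z_Γ) p.128 / Prop. 9.1 (Gr_d) p.160; joint J1 = GAP-LEDGER-HU row HU-R01 (unrefereed preprint arXiv:2507.21400v1 under adjudication, D-0012/D-0089 — kernel support on OUR typed carriers of rows 101/110; nothing of the source asserted)] -/
abbrev Rq : Type := ChartRing 9 k ⧸ gammaChartIdeal k 9 quadGamma

/-- **`hprod = ∏_{u ∈ 𝕀_{3,9} ∖ m, u ∉ Γ} x̄_u`** in the chart ring. OURS.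
[cite: Hu2025, Def. 7.1 (Z_Γ) p.128 / Prop. 9.1 «p_u ≠ 0, ∀ x_u ∈ Δ_d» p.160; joint J1 = GAP-LEDGER-HU row HU-R01 (unrefereed preprint arXiv:2507.21400v1 under adjudication, D-0012/D-0089 — kernel support on OUR typed carriers of rows 101/110; nothing of the source asserted)] -/
def hprod : ChartRing 9 k := ∏ u ∈ offGamma, xbar k u

/-- **`hq`** = the image of `hprod` in `Rq`. OURS.
[cite: Hu2025, Def. 7.1 (Z_Γ) p.128 / Prop. 9.1 p.160; joint J1 = GAP-LEDGER-HU row HU-R01 (unrefereed preprint arXiv:2507.21400v1 under adjudication, D-0012/D-0089 — kernel support on OUR typed carriers of rows 101/110; nothing of the source asserted)] -/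
def hq : Rq k := Ideal.Quotient.mk _ (hprod k)

/-- **`Rh = Rq[1/hq]`** — the coordinate ring of the open matroid Schubert cell `Z_Γ ∩ {x̄_u ≠ 0, u ∉ Γ}` of the complete
quadrilateral on the chart. OURS abbreviation.
[cite: Hu2025, Prop. 9.1 (Gr_d) p.160 / Def. 7.1 (Z_Γ) p.128; joint J1 = GAP-LEDGER-HU row HU-R01 (unrefereed preprint arXiv:2507.21400v1 under adjudication, D-0012/D-0089 — kernel support on OUR typed carriers of rows 101/110; nothing of the source asserted)] -/
abbrev Rh : Type := Localization.Away (hq k)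

/-! ## The `S`-valued point: `ψ : k[Var_𝕌] → S`, `φ : k[x_u] → S`, `Φ̄ : Rh → S` -/

/-- `algebraMap P S (X₉ X₁₂)` is a unit (it divides `D₀`).
[cite: Hu2025, Prop. 9.1 (Gr_d) p.160 / Def. 7.1 (Z_Γ) p.128; joint J1 = GAP-LEDGER-HU row HU-R01 (unrefereed preprint arXiv:2507.21400v1 under adjudication, D-0012/D-0089 — kernel support on OUR typed carriers of rows 101/110; nothing of the source asserted)] -/
theorem isUnit_den : IsUnit (algebraMap (P k) (S k) (X 9 * X 12)) := by
  have hD : IsUnit (algebraMap (P k) (S k) D0) := IsLocalization.Away.algebraMap_isUnit (D0 (k := k))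
  have e : algebraMap (P k) (S k) D0 =
      algebraMap (P k) (S k) (X 9 * X 12) * algebraMap (P k) (S k) (∏ u ∈ offGamma, minorP u) := by
    rw [← map_mul]; rfl
  rw [e] at hD
  exact isUnit_of_mul_isUnit_left hD

/-- `algebraMap P S (minorP u)` is a unit for `u ∉ Γ` (it divides `D₀`).
[cite: Hu2025, Prop. 9.1 (Gr_d) p.160 / Def. 7.1 (Z_Γ) p.128; joint J1 = GAP-LEDGER-HU row HU-R01 (unrefereed preprint arXiv:2507.21400v1 under adjudication, D-0012/D-0089 — kernel support on OUR typed carriers of rows 101/110; nothing of the source asserted)] -/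
theorem isUnit_minorP {u : ℕ × ℕ × ℕ} (hu : u ∈ offGamma) : IsUnit (algebraMap (P k) (S k) (minorP u)) := by
  have hD : IsUnit (algebraMap (P k) (S k) D0) := IsLocalization.Away.algebraMap_isUnit (D0 (k := k))
  have e : algebraMap (P k) (S k) D0 =
      algebraMap (P k) (S k) (X 9 * X 12) * ∏ u ∈ offGamma, algebraMap (P k) (S k) (minorP u) := by
    rw [← map_prod, ← map_mul]; rfl
  rw [e] at hD
  have hdvd : algebraMap (P k) (S k) (minorP u) ∣ ∏ v ∈ offGamma, algebraMap (P k) (S k) (minorP v) :=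
    Finset.dvd_prod_of_mem (fun v => algebraMap (P k) (S k) (minorP v)) hu
  exact isUnit_of_dvd_unit hdvd (isUnit_of_mul_isUnit_right hD)

/-- `⅟(p₆ r₈)` in `S`.
[cite: Hu2025, Prop. 9.1 (Gr_d) p.160 / Def. 7.1 (Z_Γ) p.128; joint J1 = GAP-LEDGER-HU row HU-R01 (unrefereed preprint arXiv:2507.21400v1 under adjudication, D-0012/D-0089 — kernel support on OUR typed carriers of rows 101/110; nothing of the source asserted)] -/
def invDen : S k := ((isUnit_den k).unit⁻¹ : (S k)ˣ)

/-- `invDen * (p₆ r₈) = 1`.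
[cite: Hu2025, Prop. 9.1 (Gr_d) p.160 / Def. 7.1 (Z_Γ) p.128; joint J1 = GAP-LEDGER-HU row HU-R01 (unrefereed preprint arXiv:2507.21400v1 under adjudication, D-0012/D-0089 — kernel support on OUR typed carriers of rows 101/110; nothing of the source asserted)] -/
theorem invDen_mul : invDen k * algebraMap (P k) (S k) (X 9 * X 12) = 1 := by
  rw [invDen]
  exact (isUnit_den k).unit.inv_mul

/-- **The columns of the `S`-valued point**: `colS a = colP a` (in `S`) for `a ≠ 9`, and `colS 9 = ⅟(p₆r₈) · a₉'` (the honest `a₉`).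
[cite: Hu2025, Prop. 9.1 (Gr_d) p.160 / Def. 7.1 (Z_Γ) p.128; joint J1 = GAP-LEDGER-HU row HU-R01 (unrefereed preprint arXiv:2507.21400v1 under adjudication, D-0012/D-0089 — kernel support on OUR typed carriers of rows 101/110; nothing of the source asserted)] -/
def colS (a : ℕ) : Fin 3 → S k :=
  if a = 9 then invDen k • ((algebraMap (P k) (S k)) ∘ colP 9) else (algebraMap (P k) (S k)) ∘ colP a

/-- **The value of the basic variable `x_t` at the `S`-valued point** (`t = (2,3,l) ↦ (a_l)_1`, `(1,3,l) ↦ −(a_l)_2`,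
`(1,2,l) ↦ (a_l)_3`, matching `chartCol`). OURS plumbing.
[cite: Hu2025, Prop. 9.1 (Gr_d) p.160 / Def. 7.1 (Z_Γ) p.128; joint J1 = GAP-LEDGER-HU row HU-R01 (unrefereed preprint arXiv:2507.21400v1 under adjudication, D-0012/D-0089 — kernel support on OUR typed carriers of rows 101/110; nothing of the source asserted)] -/
def bval (t : ℕ × ℕ × ℕ) : S k :=
  if t.1 = 2 then colS k t.2.2 0 else if t.2.1 = 3 then -colS k t.2.2 1 else colS k t.2.2 2

/-- **`ψ : k[Var_𝕌] → S`**, the basic variables evaluated at the `S`-valued point. OURS.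
[cite: Hu2025, Prop. 3.6 (k[Var_𝕌]) p.38 / Prop. 9.1 p.160; joint J1 = GAP-LEDGER-HU row HU-R01 (unrefereed preprint arXiv:2507.21400v1 under adjudication, D-0012/D-0089 — kernel support on OUR typed carriers of rows 101/110; nothing of the source asserted)] -/
def ψ : BasicRing 9 k →ₐ[k] S k := MvPolynomial.aeval fun x => bval k x.1.1

/-- `ψ` on a basic variable.
[cite: Hu2025, Prop. 9.1 (Gr_d) p.160 / Def. 7.1 (Z_Γ) p.128; joint J1 = GAP-LEDGER-HU row HU-R01 (unrefereed preprint arXiv:2507.21400v1 under adjudication, D-0012/D-0089 — kernel support on OUR typed carriers of rows 101/110; nothing of the source asserted)] -/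
theorem ψ_bvar {t : ℕ × ℕ × ℕ} (h : t ∈ plVarSet 9) (hb : ¬ IsLt t) : ψ k (bvar k t) = bval k t := by
  rw [bvar_of_mem k h hb, ψ, MvPolynomial.aeval_X]

/-- `ψ ∘ chartCol a = colS a` for `1 ≤ a ≤ 9`.
[cite: Hu2025, Prop. 9.1 (Gr_d) p.160 / Def. 7.1 (Z_Γ) p.128; joint J1 = GAP-LEDGER-HU row HU-R01 (unrefereed preprint arXiv:2507.21400v1 under adjudication, D-0012/D-0089 — kernel support on OUR typed carriers of rows 101/110; nothing of the source asserted)] -/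
theorem ψ_chartCol {a : ℕ} (ha1 : 1 ≤ a) (ha9 : a ≤ 9) : (ψ k) ∘ chartCol k a = colS k a := by
  obtain ⟨c1, c2, c3, -⟩ := colP_val (k := k)
  by_cases ha : 3 < a
  · have h23 : ((2, 3, a) : ℕ × ℕ × ℕ) ∈ plVarSet 9 := mem_plVarSet (by norm_num) (by norm_num) ha ha9 ha
    have h13 : ((1, 3, a) : ℕ × ℕ × ℕ) ∈ plVarSet 9 := mem_plVarSet (by norm_num) (by norm_num) ha ha9 ha
    have h12 : ((1, 2, a) : ℕ × ℕ × ℕ) ∈ plVarSet 9 := mem_plVarSet (by norm_num) (by norm_num) (by omega) ha9 ha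
    have n23 : ¬ IsLt ((2, 3, a) : ℕ × ℕ × ℕ) := not_isLt_of_le (by norm_num) (by norm_num) le_rfl
    have n13 : ¬ IsLt ((1, 3, a) : ℕ × ℕ × ℕ) := not_isLt_of_le (by norm_num) (by norm_num) le_rfl
    have n12 : ¬ IsLt ((1, 2, a) : ℕ × ℕ × ℕ) := not_isLt_of_le (by norm_num) (by norm_num) (by norm_num)
    rw [chartCol_of_lt k ha]
    funext i
    fin_cases i
    · simp [ψ_bvar k h23 n23, bval]
    · simp [ψ_bvar k h13 n13, bval]
    · simp [ψ_bvar k h12 n12, bval]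
  · have ha' : a = 1 ∨ a = 2 ∨ a = 3 := by omega
    have e9 : ¬ (a = 9) := by omega
    rcases ha' with rfl | rfl | rfl
    · rw [chartCol_one]; funext i; fin_cases i <;> simp [colS, c1, ψ]
    · rw [chartCol_two]; funext i; fin_cases i <;> simp [colS, c2, ψ]
    · rw [chartCol_three]; funext i; fin_cases i <;> simp [colS, c3, ψ]

/-- **The `u`-minor of the `S`-valued point**. OURS.
[cite: Hu2025, Prop. 9.1 (Gr_d) p.160 / Def. 7.1 (Z_Γ) p.128; joint J1 = GAP-LEDGER-HU row HU-R01 (unrefereed preprint arXiv:2507.21400v1 under adjudication, D-0012/D-0089 — kernel support on OUR typed carriers of rows 101/110; nothing of the source asserted)] -/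
def minorS (u : ℕ × ℕ × ℕ) : S k := det3 (colS k u.1) (colS k u.2.1) (colS k u.2.2)

/-- `ψ (chartMinor u) = minorS u` for `u ∈ 𝕀_{3,9}`.
[cite: Hu2025, Prop. 9.1 (Gr_d) p.160 / Def. 7.1 (Z_Γ) p.128; joint J1 = GAP-LEDGER-HU row HU-R01 (unrefereed preprint arXiv:2507.21400v1 under adjudication, D-0012/D-0089 — kernel support on OUR typed carriers of rows 101/110; nothing of the source asserted)] -/
theorem ψ_chartMinor {u : ℕ × ℕ × ℕ} (hu : u ∈ plIndexSet 9) : ψ k (chartMinor k u) = minorS k u := by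
  have hidx := mem_plIndexSet_iff.mp hu
  have h := map_det3 (ψ k).toRingHom (chartCol k u.1) (chartCol k u.2.1) (chartCol k u.2.2)
  rw [AlgHom.toRingHom_eq_coe, RingHom.coe_coe] at h
  rw [chartMinor, minorS, ← ψ_chartCol k (a := u.1) (by omega) (by omega),
    ← ψ_chartCol k (a := u.2.1) (by omega) (by omega), ← ψ_chartCol k (a := u.2.2) (by omega) (by omega)]
  exact h

/-- `det3` is homogeneous in the last slot.
[cite: Hu2025, Prop. 9.1 (Gr_d) p.160 / Def. 7.1 (Z_Γ) p.128; joint J1 = GAP-LEDGER-HU row HU-R01 (unrefereed preprint arXiv:2507.21400v1 under adjudication, D-0012/D-0089 — kernel support on OUR typed carriers of rows 101/110; nothing of the source asserted)] -/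
theorem det3_smul_last {R : Type*} [CommRing R] (v w x : Fin 3 → R) (c : R) :
    det3 v w (c • x) = c * det3 v w x := by
  simp only [det3_eq, Pi.smul_apply, smul_eq_mul]; ring

/-- **`minorS u = (⅟(p₆r₈))^{[9 ∈ u]} · minorP u`** for `u ∈ 𝕀_{3,9}`.
[cite: Hu2025, Prop. 9.1 (Gr_d) p.160 / Def. 7.1 (Z_Γ) p.128; joint J1 = GAP-LEDGER-HU row HU-R01 (unrefereed preprint arXiv:2507.21400v1 under adjudication, D-0012/D-0089 — kernel support on OUR typed carriers of rows 101/110; nothing of the source asserted)] -/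
theorem minorS_eq {u : ℕ × ℕ × ℕ} (hu : u ∈ plIndexSet 9) :
    minorS k u = (if u.2.2 = 9 then invDen k else 1) * algebraMap (P k) (S k) (minorP u) := by
  have hidx := mem_plIndexSet_iff.mp hu
  have h1 : u.1 ≠ 9 := by omega
  have h2 : u.2.1 ≠ 9 := by omega
  rw [minorP, map_det3, minorS, colS, if_neg h1, colS, if_neg h2, colS]
  by_cases h3 : u.2.2 = 9
  · rw [if_pos h3, if_pos h3, h3, det3_smul_last]
  · rw [if_neg h3, if_neg h3, one_mul]

/-- **The four `Γ`-minors of the `S`-valued point vanish.**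
[cite: Hu2025, Def. 7.1 (Z_Γ: x̄_u = 0 for u ∈ Γ) p.128; joint J1 = GAP-LEDGER-HU row HU-R01 (unrefereed preprint arXiv:2507.21400v1 under adjudication, D-0012/D-0089 — kernel support on OUR typed carriers of rows 101/110; nothing of the source asserted)] -/
theorem minorS_gamma {u : ℕ × ℕ × ℕ} (hu : u ∈ quadGamma) : minorS k u = 0 := by
  have hu' : u ∈ plIndexSet 9 := (Finset.mem_erase.mp (quadGamma_subset le_rfl hu)).2
  rw [minorS_eq k hu', minorP_gamma u hu, map_zero, mul_zero]

/-- **The non-`Γ` minors of the `S`-valued point are units.**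
[cite: Hu2025, Prop. 9.1 «p_u ≠ 0, ∀ x_u ∈ Δ_d» p.160; joint J1 = GAP-LEDGER-HU row HU-R01 (unrefereed preprint arXiv:2507.21400v1 under adjudication, D-0012/D-0089 — kernel support on OUR typed carriers of rows 101/110; nothing of the source asserted)] -/
theorem isUnit_minorS {u : ℕ × ℕ × ℕ} (hu : u ∈ offGamma) : IsUnit (minorS k u) := by
  have hu' : u ∈ plIndexSet 9 := (Finset.mem_erase.mp (Finset.mem_filter.mp hu).1).2
  rw [minorS_eq k hu']
  refine IsUnit.mul ?_ (isUnit_minorP k hu)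
  split_ifs
  · exact Units.isUnit _
  · exact isUnit_one

/-- **`φ : k[x_u] → S`** — the chart coordinates evaluated at the `S`-valued point (`φ = ψ ∘ chartParam`). OURS.
[cite: Hu2025, Prop. 3.6 p.38 / Prop. 9.1 p.160; joint J1 = GAP-LEDGER-HU row HU-R01 (unrefereed preprint arXiv:2507.21400v1 under adjudication, D-0012/D-0089 — kernel support on OUR typed carriers of rows 101/110; nothing of the source asserted)] -/
def φ : ChartRing 9 k →ₐ[k] S k := (ψ k).comp (chartParam 9 k)

/-- `φ (x̄_u) = minorS u` for chart indices `u`.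
[cite: Hu2025, Prop. 9.1 (Gr_d) p.160 / Def. 7.1 (Z_Γ) p.128; joint J1 = GAP-LEDGER-HU row HU-R01 (unrefereed preprint arXiv:2507.21400v1 under adjudication, D-0012/D-0089 — kernel support on OUR typed carriers of rows 101/110; nothing of the source asserted)] -/
theorem φ_xbar {u : ℕ × ℕ × ℕ} (hu : u ∈ plVarSet 9) : φ k (xbar k u) = minorS k u := by
  rw [φ, AlgHom.comp_apply, chartParam_xbar k hu, ψ_chartMinor k (Finset.mem_erase.mp hu).2]

/-- **`φ` kills the Γ-scheme ideal** `(𝓕_m) + (x̄_u : u ∈ Γ)`.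
[cite: Hu2025, Def. 7.1 (I_{℘,Γ}) p.128 / Prop. 3.6 p.38; joint J1 = GAP-LEDGER-HU row HU-R01 (unrefereed preprint arXiv:2507.21400v1 under adjudication, D-0012/D-0089 — kernel support on OUR typed carriers of rows 101/110; nothing of the source asserted)] -/
theorem φ_gammaChartIdeal : ∀ F ∈ gammaChartIdeal k 9 quadGamma, φ k F = 0 := by
  intro F hF
  rw [mem_gammaChartIdeal_iff k (quadGamma_subset le_rfl)] at hF
  have hle : gammaMinorIdeal k 9 quadGamma ≤ RingHom.ker (ψ k).toRingHom := by
    unfold gammaMinorIdeal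
    rw [Ideal.span_le]
    rintro _ ⟨u, hu, rfl⟩
    rw [SetLike.mem_coe, RingHom.mem_ker, AlgHom.toRingHom_eq_coe, RingHom.coe_coe,
      ψ_chartMinor k (Finset.mem_erase.mp (quadGamma_subset le_rfl hu)).2]
    exact minorS_gamma k hu
  have := hle hF
  rw [RingHom.mem_ker, AlgHom.toRingHom_eq_coe, RingHom.coe_coe] at this
  rw [φ, AlgHom.comp_apply]
  exact this

/-- **`Φ̄₀ : Rq → S`**. OURS.
[cite: Hu2025, Prop. 9.1 (Gr_d) p.160 / Def. 7.1 (Z_Γ) p.128; joint J1 = GAP-LEDGER-HU row HU-R01 (unrefereed preprint arXiv:2507.21400v1 under adjudication, D-0012/D-0089 — kernel support on OUR typed carriers of rows 101/110; nothing of the source asserted)] -/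
def Φq : Rq k →+* S k :=
  Ideal.Quotient.lift (gammaChartIdeal k 9 quadGamma) (φ k).toRingHom
    (fun F hF => by rw [AlgHom.toRingHom_eq_coe, RingHom.coe_coe]; exact φ_gammaChartIdeal k F hF)

/-- `Φ̄₀ (hq)` is a unit.
[cite: Hu2025, Prop. 9.1 (Gr_d) p.160 / Def. 7.1 (Z_Γ) p.128; joint J1 = GAP-LEDGER-HU row HU-R01 (unrefereed preprint arXiv:2507.21400v1 under adjudication, D-0012/D-0089 — kernel support on OUR typed carriers of rows 101/110; nothing of the source asserted)] -/
theorem isUnit_Φq_hq : IsUnit (Φq k (hq k)) := by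
  rw [hq, Φq, Ideal.Quotient.lift_mk, AlgHom.toRingHom_eq_coe, RingHom.coe_coe, hprod, map_prod,
    IsUnit.prod_iff]
  intro u hu
  rw [φ_xbar k (Finset.mem_filter.mp hu).1]
  exact isUnit_minorS k hu

/-- **`Φ̄ : Rh → S`** — the `S`-valued point extends to the localisation. OURS.
[cite: Hu2025, Prop. 9.1 (Gr_d) p.160; joint J1 = GAP-LEDGER-HU row HU-R01 (unrefereed preprint arXiv:2507.21400v1 under adjudication, D-0012/D-0089 — kernel support on OUR typed carriers of rows 101/110; nothing of the source asserted)] -/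
def Φh : Rh k →+* S k := IsLocalization.Away.lift (hq k) (isUnit_Φq_hq k)


/-! ## The `Rh`-side: minors `m u`, columns `A a`, Cramer coordinates, and the retraction `Ψ : S → Rh` -/

/-- `ι ∘ π : k[x_u] → Rh`.
[cite: Hu2025, Prop. 9.1 (Gr_d) p.160 / Def. 7.1 (Z_Γ) p.128; joint J1 = GAP-LEDGER-HU row HU-R01 (unrefereed preprint arXiv:2507.21400v1 under adjudication, D-0012/D-0089 — kernel support on OUR typed carriers of rows 101/110; nothing of the source asserted)] -/
def toRh : ChartRing 9 k →+* Rh k :=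
  (algebraMap (Rq k) (Rh k)).comp (Ideal.Quotient.mk (gammaChartIdeal k 9 quadGamma))

/-- **`m u`** — the chart coordinate `x̄_u` in `Rh`. OURS.
[cite: Hu2025, Prop. 9.1 (Gr_d) p.160 / Def. 7.1 (Z_Γ) p.128 / Prop. 3.6 p.38; joint J1 = GAP-LEDGER-HU row HU-R01 (unrefereed preprint arXiv:2507.21400v1 under adjudication, D-0012/D-0089 — kernel support on OUR typed carriers of rows 101/110; nothing of the source asserted)] -/
def m (u : ℕ × ℕ × ℕ) : Rh k := toRh k (xbar k u)

/-- **`A a`** — the `a`-th column of `[I₃ | A]` in `Rh` (entries `m(2,3,a), −m(1,3,a), m(1,2,a)` for `a > 3`). OURS.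
[cite: Hu2025, Prop. 9.1 (Gr_d) p.160 / Def. 7.1 (Z_Γ) p.128 / Prop. 3.6 p.38; joint J1 = GAP-LEDGER-HU row HU-R01 (unrefereed preprint arXiv:2507.21400v1 under adjudication, D-0012/D-0089 — kernel support on OUR typed carriers of rows 101/110; nothing of the source asserted)] -/
def A (a : ℕ) : Fin 3 → Rh k := (toRh k) ∘ (basicIncl 9 k) ∘ chartCol k a

/-- `toRh` factors through `basicIncl ∘ chartParam` (Prop. 3.6: `f − basicIncl (chartParam f) ∈ (𝓕_m) ⊆ I`).
[cite: Hu2025, Prop. 9.1 (Gr_d) p.160 / Def. 7.1 (Z_Γ) p.128 / Prop. 3.6 p.38; joint J1 = GAP-LEDGER-HU row HU-R01 (unrefereed preprint arXiv:2507.21400v1 under adjudication, D-0012/D-0089 — kernel support on OUR typed carriers of rows 101/110; nothing of the source asserted)] -/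
theorem toRh_basicIncl_chartParam (f : ChartRing 9 k) : toRh k (basicIncl 9 k (chartParam 9 k f)) = toRh k f := by
  have hmem : f - basicIncl 9 k (chartParam 9 k f) ∈ gammaChartIdeal k 9 quadGamma :=
    Ideal.mem_sup_left (sub_incl_chartParam_mem k f)
  have h0 : toRh k (f - basicIncl 9 k (chartParam 9 k f)) = 0 := by
    rw [toRh, RingHom.comp_apply, Ideal.Quotient.eq_zero_iff_mem.mpr hmem, map_zero]
  rw [map_sub, sub_eq_zero] at h0
  exact h0.symm

/-- **`m u = det3 (A u₁) (A u₂) (A u₃)`** for chart indices `u`.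
[cite: Hu2025, Prop. 9.1 (Gr_d) p.160 / Def. 7.1 (Z_Γ) p.128 / Prop. 3.6 p.38; joint J1 = GAP-LEDGER-HU row HU-R01 (unrefereed preprint arXiv:2507.21400v1 under adjudication, D-0012/D-0089 — kernel support on OUR typed carriers of rows 101/110; nothing of the source asserted)] -/
theorem m_eq_det3 {u : ℕ × ℕ × ℕ} (hu : u ∈ plVarSet 9) : m k u = det3 (A k u.1) (A k u.2.1) (A k u.2.2) := by
  rw [m, ← toRh_basicIncl_chartParam, chartParam_xbar k hu, chartMinor]
  exact map_det3 ((toRh k).comp (basicIncl 9 k).toRingHom) _ _ _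

/-- `m u = 0` for `u ∈ Γ`.
[cite: Hu2025, Prop. 9.1 (Gr_d) p.160 / Def. 7.1 (Z_Γ) p.128; joint J1 = GAP-LEDGER-HU row HU-R01 (unrefereed preprint arXiv:2507.21400v1 under adjudication, D-0012/D-0089 — kernel support on OUR typed carriers of rows 101/110; nothing of the source asserted)] -/
theorem m_gamma {u : ℕ × ℕ × ℕ} (hu : u ∈ quadGamma) : m k u = 0 := by
  rw [m, toRh, RingHom.comp_apply, Ideal.Quotient.eq_zero_iff_mem.mpr, map_zero]
  exact Ideal.mem_sup_right (Ideal.subset_span ⟨u, hu, rfl⟩)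

/-- `m u` is a unit in `Rh` for `u ∉ Γ` (it divides `hq`).
[cite: Hu2025, Prop. 9.1 (Gr_d) p.160 / Def. 7.1 (Z_Γ) p.128 / Prop. 3.6 p.38; joint J1 = GAP-LEDGER-HU row HU-R01 (unrefereed preprint arXiv:2507.21400v1 under adjudication, D-0012/D-0089 — kernel support on OUR typed carriers of rows 101/110; nothing of the source asserted)] -/
theorem isUnit_m {u : ℕ × ℕ × ℕ} (hu : u ∈ offGamma) : IsUnit (m k u) := by
  have hH : IsUnit (algebraMap (Rq k) (Rh k) (hq k)) := IsLocalization.Away.algebraMap_isUnit (hq k)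
  have e : algebraMap (Rq k) (Rh k) (hq k) = ∏ v ∈ offGamma, m k v := by
    show algebraMap (Rq k) (Rh k) (Ideal.Quotient.mk _ (∏ v ∈ offGamma, xbar k v)) = _
    rw [map_prod, map_prod]; rfl
  rw [e] at hH
  have hdvd : m k u ∣ ∏ v ∈ offGamma, m k v := Finset.dvd_prod_of_mem (fun v => m k v) hu
  exact isUnit_of_dvd_unit hdvd hH

/-- membership of the named non-`Γ` triples in `offGamma` (bookkeeping).
[cite: Hu2025, Prop. 9.1 (Gr_d) p.160 / Def. 7.1 (Z_Γ) p.128; joint J1 = GAP-LEDGER-HU row HU-R01 (unrefereed preprint arXiv:2507.21400v1 under adjudication, D-0012/D-0089 — kernel support on OUR typed carriers of rows 101/110; nothing of the source asserted)] -/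
theorem mem_offGamma :
    ((4,5,7) : ℕ × ℕ × ℕ) ∈ offGamma ∧ ((5,6,7) : ℕ × ℕ × ℕ) ∈ offGamma ∧ ((4,6,7) : ℕ × ℕ × ℕ) ∈ offGamma ∧
    ((5,7,8) : ℕ × ℕ × ℕ) ∈ offGamma ∧ ((4,5,8) : ℕ × ℕ × ℕ) ∈ offGamma ∧ ((4,5,9) : ℕ × ℕ × ℕ) ∈ offGamma ∧
    ((4,7,9) : ℕ × ℕ × ℕ) ∈ offGamma := by
  refine ⟨?_, ?_, ?_, ?_, ?_, ?_, ?_⟩ <;>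
    exact Finset.mem_filter.mpr ⟨mem_plVarSet (by norm_num) (by norm_num) (by norm_num) (by norm_num) (by norm_num),
      by simp [quadGammaFin]⟩

/-- chart-index membership of the triples used below (bookkeeping).
[cite: Hu2025, Prop. 9.1 (Gr_d) p.160 / Def. 7.1 (Z_Γ) p.128; joint J1 = GAP-LEDGER-HU row HU-R01 (unrefereed preprint arXiv:2507.21400v1 under adjudication, D-0012/D-0089 — kernel support on OUR typed carriers of rows 101/110; nothing of the source asserted)] -/
theorem mem9 {a b c : ℕ} (ha : 1 ≤ a) (hab : a < b) (hbc : b < c) (hc : c ≤ 9) (h3 : 3 < c) :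
    ((a, b, c) : ℕ × ℕ × ℕ) ∈ plVarSet 9 := mem_plVarSet ha hab hbc hc h3

/-- `m(4,5,7)⁻¹`.
[cite: Hu2025, Prop. 9.1 (Gr_d) p.160 / Def. 7.1 (Z_Γ) p.128; joint J1 = GAP-LEDGER-HU row HU-R01 (unrefereed preprint arXiv:2507.21400v1 under adjudication, D-0012/D-0089 — kernel support on OUR typed carriers of rows 101/110; nothing of the source asserted)] -/
def inv457 : Rh k := ((isUnit_m k mem_offGamma.1).unit⁻¹ : (Rh k)ˣ)

/-- `inv457 * m457 = 1`.
[cite: Hu2025, Prop. 9.1 (Gr_d) p.160 / Def. 7.1 (Z_Γ) p.128; joint J1 = GAP-LEDGER-HU row HU-R01 (unrefereed preprint arXiv:2507.21400v1 under adjudication, D-0012/D-0089 — kernel support on OUR typed carriers of rows 101/110; nothing of the source asserted)] -/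
theorem inv457_mul : inv457 k * m k (4,5,7) = 1 := by
  rw [inv457]; exact (isUnit_m k mem_offGamma.1).unit.inv_mul

/-- **The parameter values in `Rh`**: `G : Fin 14 → Rh` — the entries of `a₄, a₅, a₇`, then `p₆ = −m567/m457`, `q₆ = m467/m457`,
`p₈ = m578/m457`, `r₈ = m458/m457`, `r₉ = m459/m457` (Cramer coordinates in the basis `(a₄, a₅, a₇)`). OURS.
[cite: Hu2025, Prop. 9.1 (Gr_d) p.160 / Def. 7.1 (Z_Γ) p.128 / Prop. 3.6 p.38; joint J1 = GAP-LEDGER-HU row HU-R01 (unrefereed preprint arXiv:2507.21400v1 under adjudication, D-0012/D-0089 — kernel support on OUR typed carriers of rows 101/110; nothing of the source asserted)] -/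
def G (i : Fin 14) : Rh k :=
  match i with
  | ⟨0, _⟩ => A k 4 0
  | ⟨1, _⟩ => A k 4 1
  | ⟨2, _⟩ => A k 4 2
  | ⟨3, _⟩ => A k 5 0
  | ⟨4, _⟩ => A k 5 1
  | ⟨5, _⟩ => A k 5 2
  | ⟨6, _⟩ => A k 7 0
  | ⟨7, _⟩ => A k 7 1
  | ⟨8, _⟩ => A k 7 2
  | ⟨9, _⟩ => -(m k (5,6,7)) * inv457 k
  | ⟨10, _⟩ => m k (4,6,7) * inv457 k
  | ⟨11, _⟩ => m k (5,7,8) * inv457 k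
  | ⟨12, _⟩ => m k (4,5,8) * inv457 k
  | _ => m k (4,5,9) * inv457 k

/-- Plumbing (G0).
[cite: Hu2025, Prop. 9.1 (Gr_d) p.160 / Def. 7.1 (Z_Γ) p.128; joint J1 = GAP-LEDGER-HU row HU-R01 (unrefereed preprint arXiv:2507.21400v1 under adjudication, D-0012/D-0089 — kernel support on OUR typed carriers of rows 101/110; nothing of the source asserted)] -/
theorem G0 : G k 0 = A k 4 0 := rfl
/-- Plumbing (G1).
[cite: Hu2025, Prop. 9.1 (Gr_d) p.160 / Def. 7.1 (Z_Γ) p.128; joint J1 = GAP-LEDGER-HU row HU-R01 (unrefereed preprint arXiv:2507.21400v1 under adjudication, D-0012/D-0089 — kernel support on OUR typed carriers of rows 101/110; nothing of the source asserted)] -/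
theorem G1 : G k 1 = A k 4 1 := rfl
/-- Plumbing (G2).
[cite: Hu2025, Prop. 9.1 (Gr_d) p.160 / Def. 7.1 (Z_Γ) p.128; joint J1 = GAP-LEDGER-HU row HU-R01 (unrefereed preprint arXiv:2507.21400v1 under adjudication, D-0012/D-0089 — kernel support on OUR typed carriers of rows 101/110; nothing of the source asserted)] -/
theorem G2 : G k 2 = A k 4 2 := rfl
/-- Plumbing (G3).
[cite: Hu2025, Prop. 9.1 (Gr_d) p.160 / Def. 7.1 (Z_Γ) p.128; joint J1 = GAP-LEDGER-HU row HU-R01 (unrefereed preprint arXiv:2507.21400v1 under adjudication, D-0012/D-0089 — kernel support on OUR typed carriers of rows 101/110; nothing of the source asserted)] -/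
theorem G3 : G k 3 = A k 5 0 := rfl
/-- Plumbing (G4).
[cite: Hu2025, Prop. 9.1 (Gr_d) p.160 / Def. 7.1 (Z_Γ) p.128; joint J1 = GAP-LEDGER-HU row HU-R01 (unrefereed preprint arXiv:2507.21400v1 under adjudication, D-0012/D-0089 — kernel support on OUR typed carriers of rows 101/110; nothing of the source asserted)] -/
theorem G4 : G k 4 = A k 5 1 := rfl
/-- Plumbing (G5).
[cite: Hu2025, Prop. 9.1 (Gr_d) p.160 / Def. 7.1 (Z_Γ) p.128; joint J1 = GAP-LEDGER-HU row HU-R01 (unrefereed preprint arXiv:2507.21400v1 under adjudication, D-0012/D-0089 — kernel support on OUR typed carriers of rows 101/110; nothing of the source asserted)] -/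
theorem G5 : G k 5 = A k 5 2 := rfl
/-- Plumbing (G6).
[cite: Hu2025, Prop. 9.1 (Gr_d) p.160 / Def. 7.1 (Z_Γ) p.128; joint J1 = GAP-LEDGER-HU row HU-R01 (unrefereed preprint arXiv:2507.21400v1 under adjudication, D-0012/D-0089 — kernel support on OUR typed carriers of rows 101/110; nothing of the source asserted)] -/
theorem G6 : G k 6 = A k 7 0 := rfl
/-- Plumbing (G7).
[cite: Hu2025, Prop. 9.1 (Gr_d) p.160 / Def. 7.1 (Z_Γ) p.128; joint J1 = GAP-LEDGER-HU row HU-R01 (unrefereed preprint arXiv:2507.21400v1 under adjudication, D-0012/D-0089 — kernel support on OUR typed carriers of rows 101/110; nothing of the source asserted)] -/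
theorem G7 : G k 7 = A k 7 1 := rfl
/-- Plumbing (G8).
[cite: Hu2025, Prop. 9.1 (Gr_d) p.160 / Def. 7.1 (Z_Γ) p.128; joint J1 = GAP-LEDGER-HU row HU-R01 (unrefereed preprint arXiv:2507.21400v1 under adjudication, D-0012/D-0089 — kernel support on OUR typed carriers of rows 101/110; nothing of the source asserted)] -/
theorem G8 : G k 8 = A k 7 2 := rfl
/-- Plumbing (G9).
[cite: Hu2025, Prop. 9.1 (Gr_d) p.160 / Def. 7.1 (Z_Γ) p.128; joint J1 = GAP-LEDGER-HU row HU-R01 (unrefereed preprint arXiv:2507.21400v1 under adjudication, D-0012/D-0089 — kernel support on OUR typed carriers of rows 101/110; nothing of the source asserted)] -/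
theorem G9 : G k 9 = -(m k (5,6,7)) * inv457 k := rfl
/-- Plumbing (G10).
[cite: Hu2025, Prop. 9.1 (Gr_d) p.160 / Def. 7.1 (Z_Γ) p.128; joint J1 = GAP-LEDGER-HU row HU-R01 (unrefereed preprint arXiv:2507.21400v1 under adjudication, D-0012/D-0089 — kernel support on OUR typed carriers of rows 101/110; nothing of the source asserted)] -/
theorem G10 : G k 10 = m k (4,6,7) * inv457 k := rfl
/-- Plumbing (G11).
[cite: Hu2025, Prop. 9.1 (Gr_d) p.160 / Def. 7.1 (Z_Γ) p.128; joint J1 = GAP-LEDGER-HU row HU-R01 (unrefereed preprint arXiv:2507.21400v1 under adjudication, D-0012/D-0089 — kernel support on OUR typed carriers of rows 101/110; nothing of the source asserted)] -/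
theorem G11 : G k 11 = m k (5,7,8) * inv457 k := rfl
/-- Plumbing (G12).
[cite: Hu2025, Prop. 9.1 (Gr_d) p.160 / Def. 7.1 (Z_Γ) p.128; joint J1 = GAP-LEDGER-HU row HU-R01 (unrefereed preprint arXiv:2507.21400v1 under adjudication, D-0012/D-0089 — kernel support on OUR typed carriers of rows 101/110; nothing of the source asserted)] -/
theorem G12 : G k 12 = m k (4,5,8) * inv457 k := rfl
/-- Plumbing (G13).
[cite: Hu2025, Prop. 9.1 (Gr_d) p.160 / Def. 7.1 (Z_Γ) p.128; joint J1 = GAP-LEDGER-HU row HU-R01 (unrefereed preprint arXiv:2507.21400v1 under adjudication, D-0012/D-0089 — kernel support on OUR typed carriers of rows 101/110; nothing of the source asserted)] -/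
theorem G13 : G k 13 = m k (4,5,9) * inv457 k := rfl

/-- **`ψ₀ : P → Rh`**, `Xᵢ ↦ G i`. OURS.
[cite: Hu2025, Prop. 9.1 (Gr_d) p.160 / Def. 7.1 (Z_Γ) p.128; joint J1 = GAP-LEDGER-HU row HU-R01 (unrefereed preprint arXiv:2507.21400v1 under adjudication, D-0012/D-0089 — kernel support on OUR typed carriers of rows 101/110; nothing of the source asserted)] -/
def ψ₀ : P k →ₐ[k] Rh k := MvPolynomial.aeval (G k)

/-- `ψ₀ (Xᵢ) = G i`.
[cite: Hu2025, Prop. 9.1 (Gr_d) p.160 / Def. 7.1 (Z_Γ) p.128; joint J1 = GAP-LEDGER-HU row HU-R01 (unrefereed preprint arXiv:2507.21400v1 under adjudication, D-0012/D-0089 — kernel support on OUR typed carriers of rows 101/110; nothing of the source asserted)] -/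
theorem ψ₀_X (i : Fin 14) : ψ₀ k (X i) = G k i := by rw [ψ₀, MvPolynomial.aeval_X]

/-- det3 swap/cycle identities (generic).
[cite: Hu2025, Prop. 9.1 (Gr_d) p.160 / Def. 7.1 (Z_Γ) p.128; joint J1 = GAP-LEDGER-HU row HU-R01 (unrefereed preprint arXiv:2507.21400v1 under adjudication, D-0012/D-0089 — kernel support on OUR typed carriers of rows 101/110; nothing of the source asserted)] -/
theorem det3_swap12 {R : Type*} [CommRing R] (v w x : Fin 3 → R) : det3 w v x = - det3 v w x := by
  simp only [det3_eq]; ring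
/-- Plumbing (det3_swap23).
[cite: Hu2025, Prop. 9.1 (Gr_d) p.160 / Def. 7.1 (Z_Γ) p.128; joint J1 = GAP-LEDGER-HU row HU-R01 (unrefereed preprint arXiv:2507.21400v1 under adjudication, D-0012/D-0089 — kernel support on OUR typed carriers of rows 101/110; nothing of the source asserted)] -/
theorem det3_swap23 {R : Type*} [CommRing R] (v w x : Fin 3 → R) : det3 v x w = - det3 v w x := by
  simp only [det3_eq]; ring
/-- Plumbing (det3_cycle).
[cite: Hu2025, Prop. 9.1 (Gr_d) p.160 / Def. 7.1 (Z_Γ) p.128; joint J1 = GAP-LEDGER-HU row HU-R01 (unrefereed preprint arXiv:2507.21400v1 under adjudication, D-0012/D-0089 — kernel support on OUR typed carriers of rows 101/110; nothing of the source asserted)] -/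
theorem det3_cycle {R : Type*} [CommRing R] (v w x : Fin 3 → R) : det3 x v w = det3 v w x := by
  simp only [det3_eq]; ring

/-- The generic «three collinearities» determinant: `det3 (p•v+q•w) (p'•v+r'•x) (q''•w+r''•x) = −(p r' q'' + q p' r'')·det3 v w x`.
[cite: Hu2025, Prop. 9.1 (Gr_d) p.160 / Def. 7.1 (Z_Γ) p.128; joint J1 = GAP-LEDGER-HU row HU-R01 (unrefereed preprint arXiv:2507.21400v1 under adjudication, D-0012/D-0089 — kernel support on OUR typed carriers of rows 101/110; nothing of the source asserted)] -/
theorem det3_combo {R : Type*} [CommRing R] (v w x : Fin 3 → R) (p q p' r' q'' r'' : R) :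
    det3 (p • v + q • w) (p' • v + r' • x) (q'' • w + r'' • x) = -(p * r' * q'' + q * p' * r'') * det3 v w x := by
  simp only [det3_eq, Pi.add_apply, Pi.smul_apply, smul_eq_mul]; ring

/-- **(K6)** `A₆ = p₆•A₄ + q₆•A₅` in `Rh` (Cramer in the basis `(a₄,a₅,a₇)`, using `m456 = 0`).
[cite: Hu2025, Prop. 9.1 (Gr_d) p.160 / Def. 7.1 (Z_Γ) p.128 / Prop. 3.6 p.38; joint J1 = GAP-LEDGER-HU row HU-R01 (unrefereed preprint arXiv:2507.21400v1 under adjudication, D-0012/D-0089 — kernel support on OUR typed carriers of rows 101/110; nothing of the source asserted)] -/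
theorem A6_eq : A k 6 = (G k 9) • A k 4 + (G k 10) • A k 5 := by
  have hc := cramer3 (A k 4) (A k 5) (A k 7) (A k 6)
  have e457 : det3 (A k 4) (A k 5) (A k 7) = m k (4,5,7) :=
    (m_eq_det3 k (mem9 (by norm_num) (by norm_num) (by norm_num) (by norm_num) (by norm_num))).symm
  have e657 : det3 (A k 6) (A k 5) (A k 7) = - m k (5,6,7) := by
    rw [det3_swap12, m_eq_det3 k (mem9 (by norm_num) (by norm_num) (by norm_num) (by norm_num) (by norm_num))]
  have e467 : det3 (A k 4) (A k 6) (A k 7) = m k (4,6,7) :=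
    (m_eq_det3 k (mem9 (by norm_num) (by norm_num) (by norm_num) (by norm_num) (by norm_num))).symm
  have e456 : det3 (A k 4) (A k 5) (A k 6) = 0 := by
    rw [← m_eq_det3 k (mem9 (by norm_num) (by norm_num) (by norm_num) (by norm_num) (by norm_num))]
    exact m_gamma k (by simp [quadGamma])
  rw [e457, e657, e467, e456, zero_smul, add_zero] at hc
  have h2 := congrArg (fun v => inv457 k • v) hc
  simp only [smul_smul, inv457_mul, one_smul, smul_add] at h2
  rw [h2, G9, G10, mul_comm (inv457 k), mul_comm (inv457 k), neg_mul]


/-- **(K8)** `A₈ = p₈•A₄ + r₈•A₇` in `Rh` (Cramer, using `m478 = 0`).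
[cite: Hu2025, Prop. 9.1 (Gr_d) p.160 / Def. 7.1 (Z_Γ) p.128 / Prop. 3.6 p.38; joint J1 = GAP-LEDGER-HU row HU-R01 (unrefereed preprint arXiv:2507.21400v1 under adjudication, D-0012/D-0089 — kernel support on OUR typed carriers of rows 101/110; nothing of the source asserted)] -/
theorem A8_eq : A k 8 = (G k 11) • A k 4 + (G k 12) • A k 7 := by
  have hc := cramer3 (A k 4) (A k 5) (A k 7) (A k 8)
  have e457 : det3 (A k 4) (A k 5) (A k 7) = m k (4,5,7) := (m_eq_det3 k (mem9 (by norm_num) (by norm_num) (by norm_num) (by norm_num) (by norm_num))).symm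
  have e857 : det3 (A k 8) (A k 5) (A k 7) = m k (5,7,8) := by
    rw [det3_cycle, m_eq_det3 k (mem9 (by norm_num) (by norm_num) (by norm_num) (by norm_num) (by norm_num))]
  have e487 : det3 (A k 4) (A k 8) (A k 7) = 0 := by
    rw [det3_swap23, ← m_eq_det3 k (mem9 (by norm_num) (by norm_num) (by norm_num) (by norm_num) (by norm_num)), m_gamma k (by simp [quadGamma]), neg_zero]
  have e458 : det3 (A k 4) (A k 5) (A k 8) = m k (4,5,8) := (m_eq_det3 k (mem9 (by norm_num) (by norm_num) (by norm_num) (by norm_num) (by norm_num))).symm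
  rw [e457, e857, e487, e458, zero_smul, add_zero] at hc
  have h2 := congrArg (fun v => inv457 k • v) hc
  simp only [smul_smul, inv457_mul, one_smul, smul_add] at h2
  rw [h2, G11, G12, mul_comm (inv457 k), mul_comm (inv457 k)]

/-- **(K9′)** `A₉ = q₉•A₅ + r₉•A₇` with `q₉ = −m479/m457`, `r₉ = m459/m457` (Cramer, using `m579 = 0`).
[cite: Hu2025, Prop. 9.1 (Gr_d) p.160 / Def. 7.1 (Z_Γ) p.128 / Prop. 3.6 p.38; joint J1 = GAP-LEDGER-HU row HU-R01 (unrefereed preprint arXiv:2507.21400v1 under adjudication, D-0012/D-0089 — kernel support on OUR typed carriers of rows 101/110; nothing of the source asserted)] -/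
theorem A9_eq : A k 9 = (-(m k (4,7,9)) * inv457 k) • A k 5 + (G k 13) • A k 7 := by
  have hc := cramer3 (A k 4) (A k 5) (A k 7) (A k 9)
  have e457 : det3 (A k 4) (A k 5) (A k 7) = m k (4,5,7) := (m_eq_det3 k (mem9 (by norm_num) (by norm_num) (by norm_num) (by norm_num) (by norm_num))).symm
  have e957 : det3 (A k 9) (A k 5) (A k 7) = 0 := by
    rw [det3_cycle, ← m_eq_det3 k (mem9 (by norm_num) (by norm_num) (by norm_num) (by norm_num) (by norm_num))]; exact m_gamma k (by simp [quadGamma])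
  have e497 : det3 (A k 4) (A k 9) (A k 7) = - m k (4,7,9) := by
    rw [det3_swap23, m_eq_det3 k (mem9 (by norm_num) (by norm_num) (by norm_num) (by norm_num) (by norm_num))]
  have e459 : det3 (A k 4) (A k 5) (A k 9) = m k (4,5,9) := (m_eq_det3 k (mem9 (by norm_num) (by norm_num) (by norm_num) (by norm_num) (by norm_num))).symm
  rw [e457, e957, e497, e459, zero_smul, zero_add] at hc
  have h2 := congrArg (fun v => inv457 k • v) hc
  simp only [smul_smul, inv457_mul, one_smul, smul_add] at h2
  rw [h2, G13, mul_comm (inv457 k), mul_comm (inv457 k), neg_mul]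

/-- **The cubic relation** `p₆ r₈ q₉ + q₆ p₈ r₉ = 0` in `Rh` — the fourth collinearity `m689 = 0` in Cramer coordinates.
[cite: Hu2025, Prop. 9.1 (Gr_d) p.160 / Def. 7.1 (Z_Γ) p.128 / Prop. 3.6 p.38; joint J1 = GAP-LEDGER-HU row HU-R01 (unrefereed preprint arXiv:2507.21400v1 under adjudication, D-0012/D-0089 — kernel support on OUR typed carriers of rows 101/110; nothing of the source asserted)] -/
theorem cubic_rel :
    G k 9 * G k 12 * (-(m k (4,7,9)) * inv457 k) + G k 10 * G k 11 * G k 13 = 0 := by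
  have h689 : det3 (A k 6) (A k 8) (A k 9) = 0 := by
    rw [← m_eq_det3 k (mem9 (by norm_num) (by norm_num) (by norm_num) (by norm_num) (by norm_num))]; exact m_gamma k (by simp [quadGamma])
  rw [A6_eq, A8_eq, A9_eq, det3_combo, ← m_eq_det3 k (mem9 (by norm_num) (by norm_num) (by norm_num) (by norm_num) (by norm_num))] at h689
  -- `-(p r' q'' + q p' r'') * m457 = 0` with `m457` a unit
  have hu := isUnit_m k mem_offGamma.1
  have h2 : (G k 9 * G k 12 * (-(m k (4,7,9)) * inv457 k) + G k 10 * G k 11 * G k 13) * m k (4,5,7) = 0 := by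
    have := h689
    rw [neg_mul, neg_eq_zero] at this
    exact this
  exact (hu.mul_left_eq_zero).mp h2

/-- **(K9)** `(p₆r₈)•A₉ = (−q₆p₈r₉)•A₅ + (p₆r₈r₉)•A₇` in `Rh`.
[cite: Hu2025, Prop. 9.1 (Gr_d) p.160 / Def. 7.1 (Z_Γ) p.128 / Prop. 3.6 p.38; joint J1 = GAP-LEDGER-HU row HU-R01 (unrefereed preprint arXiv:2507.21400v1 under adjudication, D-0012/D-0089 — kernel support on OUR typed carriers of rows 101/110; nothing of the source asserted)] -/
theorem A9_scaled : (G k 9 * G k 12) • A k 9 = (-(G k 10 * G k 11 * G k 13)) • A k 5 + (G k 9 * G k 12 * G k 13) • A k 7 := by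
  rw [A9_eq, smul_add, smul_smul, smul_smul]
  have hc := cubic_rel k
  rw [add_eq_zero_iff_eq_neg] at hc
  rw [hc]

/-! ## `ψ₀` on the parametrised columns and minors -/

/-- The basis columns under `ψ₀`.
[cite: Hu2025, Prop. 9.1 (Gr_d) p.160 / Def. 7.1 (Z_Γ) p.128; joint J1 = GAP-LEDGER-HU row HU-R01 (unrefereed preprint arXiv:2507.21400v1 under adjudication, D-0012/D-0089 — kernel support on OUR typed carriers of rows 101/110; nothing of the source asserted)] -/
theorem ψ₀_b : (ψ₀ k) ∘ b4 = A k 4 ∧ (ψ₀ k) ∘ b5 = A k 5 ∧ (ψ₀ k) ∘ b7 = A k 7 := by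
  refine ⟨?_, ?_, ?_⟩ <;> funext i <;> fin_cases i <;>
    simp [b4, b5, b7, ψ₀_X, G0, G1, G2, G3, G4, G5, G6, G7, G8]

/-- The frame columns in `Rh` are the unit vectors.
[cite: Hu2025, Prop. 9.1 (Gr_d) p.160 / Def. 7.1 (Z_Γ) p.128; joint J1 = GAP-LEDGER-HU row HU-R01 (unrefereed preprint arXiv:2507.21400v1 under adjudication, D-0012/D-0089 — kernel support on OUR typed carriers of rows 101/110; nothing of the source asserted)] -/
theorem A_frame : A k 1 = ![1, 0, 0] ∧ A k 2 = ![0, 1, 0] ∧ A k 3 = ![0, 0, 1] := by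
  refine ⟨?_, ?_, ?_⟩
  · funext i; rw [A, Function.comp_apply, Function.comp_apply, chartCol_one]; fin_cases i <;> simp
  · funext i; rw [A, Function.comp_apply, Function.comp_apply, chartCol_two]; fin_cases i <;> simp
  · funext i; rw [A, Function.comp_apply, Function.comp_apply, chartCol_three]; fin_cases i <;> simp

/-- **`ψ₀ ∘ colP a = c_a • A a`** with `c₉ = p₆r₈` and `c_a = 1` otherwise (`1 ≤ a ≤ 9`).
[cite: Hu2025, Prop. 9.1 (Gr_d) p.160 / Def. 7.1 (Z_Γ) p.128 / Prop. 3.6 p.38; joint J1 = GAP-LEDGER-HU row HU-R01 (unrefereed preprint arXiv:2507.21400v1 under adjudication, D-0012/D-0089 — kernel support on OUR typed carriers of rows 101/110; nothing of the source asserted)] -/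
theorem ψ₀_colP {a : ℕ} (ha1 : 1 ≤ a) (ha9 : a ≤ 9) :
    (ψ₀ k) ∘ colP a = (if a = 9 then G k 9 * G k 12 else 1) • A k a := by
  obtain ⟨c1, c2, c3, c4, c5, c7, c6, c8, c9⟩ := colP_val (k := k)
  obtain ⟨e4, e5, e7⟩ := ψ₀_b k
  obtain ⟨f1, f2, f3⟩ := A_frame k
  have hψ : ∀ (c : P k) (v : Fin 3 → P k), (ψ₀ k) ∘ (c • v) = (ψ₀ k c) • ((ψ₀ k) ∘ v) := by
    intro c v; funext i; simp
  have hψadd : ∀ (v w : Fin 3 → P k), (ψ₀ k) ∘ (v + w) = (ψ₀ k) ∘ v + (ψ₀ k) ∘ w := by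
    intro v w; funext i; simp
  have ha : a = 1 ∨ a = 2 ∨ a = 3 ∨ a = 4 ∨ a = 5 ∨ a = 6 ∨ a = 7 ∨ a = 8 ∨ a = 9 := by omega
  rcases ha with rfl | rfl | rfl | rfl | rfl | rfl | rfl | rfl | rfl
  · rw [c1, f1]; funext i; fin_cases i <;> simp
  · rw [c2, f2]; funext i; fin_cases i <;> simp
  · rw [c3, f3]; funext i; fin_cases i <;> simp
  · rw [c4, e4]; simp
  · rw [c5, e5]; simp
  · rw [c6, hψadd, hψ, hψ, e4, e5, ψ₀_X, ψ₀_X, A6_eq]; simp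
  · rw [c7, e7]; simp
  · rw [c8, hψadd, hψ, hψ, e4, e7, ψ₀_X, ψ₀_X, A8_eq]; simp
  · rw [if_pos rfl, A9_scaled, c9, hψadd, hψ, hψ, e5, e7]
    simp [ψ₀_X]

/-- **`ψ₀ (minorP u) = c_u · m u`** for chart indices `u` (`c_u = p₆r₈` if `9 ∈ u`, else `1`).
[cite: Hu2025, Prop. 9.1 (Gr_d) p.160 / Def. 7.1 (Z_Γ) p.128 / Prop. 3.6 p.38; joint J1 = GAP-LEDGER-HU row HU-R01 (unrefereed preprint arXiv:2507.21400v1 under adjudication, D-0012/D-0089 — kernel support on OUR typed carriers of rows 101/110; nothing of the source asserted)] -/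
theorem ψ₀_minorP {u : ℕ × ℕ × ℕ} (hu : u ∈ plVarSet 9) :
    ψ₀ k (minorP u) = (if u.2.2 = 9 then G k 9 * G k 12 else 1) * m k u := by
  have hidx := mem_plIndexSet_iff.mp (Finset.mem_erase.mp hu).2
  have h1 : u.1 ≠ 9 := by omega
  have h2 : u.2.1 ≠ 9 := by omega
  rw [minorP, ← AlgHom.coe_toRingHom, map_det3, AlgHom.coe_toRingHom,
    ψ₀_colP k (a := u.1) (by omega) (by omega), ψ₀_colP k (a := u.2.1) (by omega) (by omega),
    ψ₀_colP k (a := u.2.2) (by omega) (by omega), if_neg h1, if_neg h2, one_smul, one_smul, det3_smul_last,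
    m_eq_det3 k hu]

/-- `p₆ r₈` is a unit in `Rh`.
[cite: Hu2025, Prop. 9.1 (Gr_d) p.160 / Def. 7.1 (Z_Γ) p.128; joint J1 = GAP-LEDGER-HU row HU-R01 (unrefereed preprint arXiv:2507.21400v1 under adjudication, D-0012/D-0089 — kernel support on OUR typed carriers of rows 101/110; nothing of the source asserted)] -/
theorem isUnit_G9G12 : IsUnit (G k 9 * G k 12) := by
  have h567 := isUnit_m k mem_offGamma.2.1
  have h458 := isUnit_m k mem_offGamma.2.2.2.2.1
  have hinv : IsUnit (inv457 k) := Units.isUnit _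
  rw [G9, G12]
  exact (h567.neg.mul hinv).mul (h458.mul hinv)

/-- **`ψ₀ (D₀)` is a unit in `Rh`.**
[cite: Hu2025, Prop. 9.1 (Gr_d) p.160 / Def. 7.1 (Z_Γ) p.128 / Prop. 3.6 p.38; joint J1 = GAP-LEDGER-HU row HU-R01 (unrefereed preprint arXiv:2507.21400v1 under adjudication, D-0012/D-0089 — kernel support on OUR typed carriers of rows 101/110; nothing of the source asserted)] -/
theorem isUnit_ψ₀_D0 : IsUnit (ψ₀ k D0) := by
  have e : ψ₀ k D0 = ψ₀ k (X 9 * X 12) * ∏ u ∈ offGamma, ψ₀ k (minorP u) := by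
    rw [← map_prod, ← map_mul]; rfl
  rw [e, map_mul, ψ₀_X, ψ₀_X, IsUnit.mul_iff, IsUnit.prod_iff]
  refine ⟨isUnit_G9G12 k, fun u hu => ?_⟩
  rw [ψ₀_minorP k (Finset.mem_filter.mp hu).1]
  refine IsUnit.mul ?_ (isUnit_m k hu)
  split_ifs
  · exact isUnit_G9G12 k
  · exact isUnit_one

/-- **`Ψ : S → Rh`**, the retraction. OURS.
[cite: Hu2025, Prop. 9.1 (Gr_d) p.160 / Def. 7.1 (Z_Γ) p.128; joint J1 = GAP-LEDGER-HU row HU-R01 (unrefereed preprint arXiv:2507.21400v1 under adjudication, D-0012/D-0089 — kernel support on OUR typed carriers of rows 101/110; nothing of the source asserted)] -/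
def Ψ : S k →+* Rh k := IsLocalization.Away.lift (D0 (k := k)) (g := (ψ₀ k).toRingHom) (isUnit_ψ₀_D0 k)

/-- Plumbing (Ψ_algebraMap).
[cite: Hu2025, Prop. 9.1 (Gr_d) p.160 / Def. 7.1 (Z_Γ) p.128; joint J1 = GAP-LEDGER-HU row HU-R01 (unrefereed preprint arXiv:2507.21400v1 under adjudication, D-0012/D-0089 — kernel support on OUR typed carriers of rows 101/110; nothing of the source asserted)] -/
theorem Ψ_algebraMap (x : P k) : Ψ k (algebraMap (P k) (S k) x) = ψ₀ k x :=
  IsLocalization.Away.lift_eq _ _ x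

/-- `Ψ (invDen) * (p₆ r₈) = 1`.
[cite: Hu2025, Prop. 9.1 (Gr_d) p.160 / Def. 7.1 (Z_Γ) p.128; joint J1 = GAP-LEDGER-HU row HU-R01 (unrefereed preprint arXiv:2507.21400v1 under adjudication, D-0012/D-0089 — kernel support on OUR typed carriers of rows 101/110; nothing of the source asserted)] -/
theorem Ψ_invDen_mul : Ψ k (invDen k) * (G k 9 * G k 12) = 1 := by
  have h := congrArg (Ψ k) (invDen_mul k)
  rwa [map_mul, map_one, Ψ_algebraMap, map_mul, ψ₀_X, ψ₀_X] at h

/-- **`Ψ ∘ colS a = A a`** (`1 ≤ a ≤ 9`): the retraction sends the `S`-valued point back to the universal point of the cell.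
[cite: Hu2025, Prop. 9.1 (Gr_d) p.160 / Def. 7.1 (Z_Γ) p.128 / Prop. 3.6 p.38; joint J1 = GAP-LEDGER-HU row HU-R01 (unrefereed preprint arXiv:2507.21400v1 under adjudication, D-0012/D-0089 — kernel support on OUR typed carriers of rows 101/110; nothing of the source asserted)] -/
theorem Ψ_colS {a : ℕ} (ha1 : 1 ≤ a) (ha9 : a ≤ 9) : (Ψ k) ∘ colS k a = A k a := by
  have hcomp : (Ψ k) ∘ ((algebraMap (P k) (S k)) ∘ colP a) = (ψ₀ k) ∘ colP a := by
    funext i; exact Ψ_algebraMap k _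
  by_cases h9 : a = 9
  · subst h9
    rw [colS, if_pos rfl]
    funext i
    rw [Function.comp_apply, Pi.smul_apply, smul_eq_mul, map_mul, ← Function.comp_apply (f := Ψ k)
      (g := (algebraMap (P k) (S k)) ∘ colP 9), hcomp, ψ₀_colP k (by norm_num) le_rfl, if_pos rfl,
      Pi.smul_apply, smul_eq_mul, ← mul_assoc, Ψ_invDen_mul, one_mul]
  · rw [colS, if_neg h9, hcomp, ψ₀_colP k ha1 ha9, if_neg h9, one_smul]

/-! ## `Ψ ∘ Φ̄ = id` and the main theorem -/

/-- The entries of `A l` (`3 < l ≤ 9`) are `m(2,3,l), −m(1,3,l), m(1,2,l)`.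
[cite: Hu2025, Prop. 9.1 (Gr_d) p.160 / Def. 7.1 (Z_Γ) p.128; joint J1 = GAP-LEDGER-HU row HU-R01 (unrefereed preprint arXiv:2507.21400v1 under adjudication, D-0012/D-0089 — kernel support on OUR typed carriers of rows 101/110; nothing of the source asserted)] -/
theorem A_of_lt {l : ℕ} (hl : 3 < l) (hl9 : l ≤ 9) :
    A k l = ![m k (2,3,l), -(m k (1,3,l)), m k (1,2,l)] := by
  have h23 : ((2, 3, l) : ℕ × ℕ × ℕ) ∈ plVarSet 9 := mem_plVarSet (by norm_num) (by norm_num) hl hl9 hl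
  have h13 : ((1, 3, l) : ℕ × ℕ × ℕ) ∈ plVarSet 9 := mem_plVarSet (by norm_num) (by norm_num) hl hl9 hl
  have h12 : ((1, 2, l) : ℕ × ℕ × ℕ) ∈ plVarSet 9 := mem_plVarSet (by norm_num) (by norm_num) (by omega) hl9 hl
  have n23 : ¬ IsLt ((2, 3, l) : ℕ × ℕ × ℕ) := not_isLt_of_le (by norm_num) (by norm_num) le_rfl
  have n13 : ¬ IsLt ((1, 3, l) : ℕ × ℕ × ℕ) := not_isLt_of_le (by norm_num) (by norm_num) le_rfl
  have n12 : ¬ IsLt ((1, 2, l) : ℕ × ℕ × ℕ) := not_isLt_of_le (by norm_num) (by norm_num) (by norm_num)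
  rw [A, chartCol_of_lt k hl]
  funext i
  fin_cases i <;> simp [m, basicIncl_bvar k h23 n23, basicIncl_bvar k h13 n13, basicIncl_bvar k h12 n12]

/-- **`Ψ (ψ b) = toRh (basicIncl b)`** for every `b ∈ k[Var_𝕌]`.
[cite: Hu2025, Prop. 9.1 (Gr_d) p.160 / Def. 7.1 (Z_Γ) p.128 / Prop. 3.6 p.38; joint J1 = GAP-LEDGER-HU row HU-R01 (unrefereed preprint arXiv:2507.21400v1 under adjudication, D-0012/D-0089 — kernel support on OUR typed carriers of rows 101/110; nothing of the source asserted)] -/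
theorem Ψ_ψ : ((Ψ k).comp (ψ k).toRingHom) = (toRh k).comp (basicIncl 9 k).toRingHom := by
  refine MvPolynomial.ringHom_ext (fun r => ?_) (fun x => ?_)
  · -- constants
    rw [RingHom.comp_apply, RingHom.comp_apply, AlgHom.toRingHom_eq_coe, AlgHom.toRingHom_eq_coe, RingHom.coe_coe,
      RingHom.coe_coe, ← MvPolynomial.algebraMap_eq, AlgHom.commutes, AlgHom.commutes,
      IsScalarTower.algebraMap_apply k (P k) (S k), Ψ_algebraMap, AlgHom.commutes,
      IsScalarTower.algebraMap_apply k (Rq k) (Rh k), IsScalarTower.algebraMap_apply k (ChartRing 9 k) (Rq k)]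
    rfl
  · -- basic variables
    obtain ⟨⟨t, ht⟩, hb⟩ := x
    rw [RingHom.comp_apply, RingHom.comp_apply, AlgHom.toRingHom_eq_coe, AlgHom.toRingHom_eq_coe, RingHom.coe_coe,
      RingHom.coe_coe]
    have hbv : (X ⟨⟨t, ht⟩, hb⟩ : BasicRing 9 k) = bvar k t := (bvar_of_mem k ht hb).symm
    rw [hbv, ψ_bvar k ht hb, basicIncl_bvar k ht hb]
    -- t = (i,j,l) basic: 1 ≤ i < j ≤ 3 < l ≤ 9
    obtain ⟨a, b, c⟩ := t
    have hidx := mem_plIndexSet_iff.mp (Finset.mem_erase.mp ht).2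
    have hne : (a, b, c) ≠ mTri := (Finset.mem_erase.mp ht).1
    simp only at hidx
    have hb3 : b ≤ 3 := by
      by_contra h
      exact hb (isLt_of_lt (by omega) (by omega))
    have hc3 : 3 < c := by
      by_contra h
      apply hne; unfold mTri; simp only [Prod.mk.injEq]; omega
    have hA : ∀ i, Ψ k (colS k c i) = A k c i := fun i =>
      congrFun (Ψ_colS k (a := c) (by omega) (by omega)) i
    have hAl := A_of_lt k hc3 (by omega)
    have hab : (a = 2 ∧ b = 3) ∨ (a = 1 ∧ b = 3) ∨ (a = 1 ∧ b = 2) := by omega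
    rcases hab with ⟨rfl, rfl⟩ | ⟨rfl, rfl⟩ | ⟨rfl, rfl⟩
    · show Ψ k (bval k (2, 3, c)) = m k (2, 3, c)
      have e : bval k (2, 3, c) = colS k c 0 := by simp [bval]
      rw [e, hA, hAl]; simp
    · show Ψ k (bval k (1, 3, c)) = m k (1, 3, c)
      have e : bval k (1, 3, c) = -colS k c 1 := by simp [bval]
      rw [e, map_neg, hA, hAl]; simp
    · show Ψ k (bval k (1, 2, c)) = m k (1, 2, c)
      have e : bval k (1, 2, c) = colS k c 2 := by simp [bval]
      rw [e, hA, hAl]; simp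

/-- **`Ψ ∘ Φ̄ = id`** on `Rh`.
[cite: Hu2025, Prop. 9.1 (Gr_d) p.160 / Def. 7.1 (Z_Γ) p.128 / Prop. 3.6 p.38; joint J1 = GAP-LEDGER-HU row HU-R01 (unrefereed preprint arXiv:2507.21400v1 under adjudication, D-0012/D-0089 — kernel support on OUR typed carriers of rows 101/110; nothing of the source asserted)] -/
theorem Ψ_comp_Φh : (Ψ k).comp (Φh k) = RingHom.id (Rh k) := by
  apply IsLocalization.ringHom_ext (Submonoid.powers (hq k))
  apply Ideal.Quotient.ringHom_ext
  ext f
  · -- constants: both sides are `k`-compatible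
    simp only [RingHom.comp_apply, RingHom.id_apply]
    rw [Φh, IsLocalization.Away.lift_eq, Φq, Ideal.Quotient.lift_mk, AlgHom.toRingHom_eq_coe, RingHom.coe_coe, φ,
      AlgHom.comp_apply]
    have := congrFun (congrArg DFunLike.coe (Ψ_ψ k)) (chartParam 9 k (C f))
    simp only [RingHom.comp_apply, AlgHom.toRingHom_eq_coe, RingHom.coe_coe] at this
    rw [this, toRh_basicIncl_chartParam]
    rfl
  · simp only [RingHom.comp_apply, RingHom.id_apply]
    rw [Φh, IsLocalization.Away.lift_eq, Φq, Ideal.Quotient.lift_mk, AlgHom.toRingHom_eq_coe, RingHom.coe_coe, φ,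
      AlgHom.comp_apply]
    have := congrFun (congrArg DFunLike.coe (Ψ_ψ k)) (chartParam 9 k (X f))
    simp only [RingHom.comp_apply, AlgHom.toRingHom_eq_coe, RingHom.coe_coe] at this
    rw [this, toRh_basicIncl_chartParam]
    rfl

/-- **`Φ̄ : Rh → S` is injective.**
[cite: Hu2025, Prop. 9.1 (Gr_d) p.160 / Def. 7.1 (Z_Γ) p.128; joint J1 = GAP-LEDGER-HU row HU-R01 (unrefereed preprint arXiv:2507.21400v1 under adjudication, D-0012/D-0089 — kernel support on OUR typed carriers of rows 101/110; nothing of the source asserted)] -/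
theorem Φh_injective : Function.Injective (Φh k) := by
  intro x y h
  have := congrArg (Ψ k) h
  rwa [← RingHom.comp_apply, ← RingHom.comp_apply, Ψ_comp_Φh, RingHom.id_apply, RingHom.id_apply] at this

/-- **MAIN THEOREM (W9): the open matroid Schubert cell of the complete quadrilateral is INTEGRAL** — the localised Γ-scheme
ring `Rh = (k[x_u] ⧸ ((𝓕_m) + (x̄_u : u ∈ Γ)))[1/∏_{u ∉ Γ} x̄_u]` is a domain (`k` a field of characteristic `0`), although the
Γ-scheme ring itself is NOT (`GammaQuadNotIntegral.not_isDomain_gammaChart_quad_nine`): `Z_Γ` has a second component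
(«all of `a₄,…,a₉` collinear») MISSING the cell. In the J1 reading «`X = Gr_d/T` integral ⇒ `Z_{Γ_d}` integral»
([Hu22] p.131 l.40–41) for the realised family `d` of the quadrilateral (`GammaQuadHuMatroid`), the antecedent-side object
(the cell) is integral while the conclusion fails. OURS; nothing of [Hu25]/[Hu22] is asserted.
[cite: Hu2025, Prop. 9.1 (Gr_d) p.160 / Def. 7.1 (Z_Γ) p.128 / Prop. 3.6 p.38; joint J1 = GAP-LEDGER-HU row HU-R01 (unrefereed preprint arXiv:2507.21400v1 under adjudication, D-0012/D-0089 — kernel support on OUR typed carriers of rows 101/110; nothing of the source asserted)] -/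
theorem isDomain_awayGammaChart_quad [CharZero k] : IsDomain (Rh k) := by
  haveI : IsDomain (S k) := isDomain_S
  exact Function.Injective.isDomain (Φh k) (Φh_injective k)

end QuadCell

end Literature.AlgebraicGeometry.Hu2025.Statements.S03Pluecker

end
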